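import Mathlib
import HarnessLib
import Literature.MathematicalPhysics.StatisticalMechanics.RenormalisationMapTermLipschitz

/-!
# The summed Lipschitz estimate of the reblocked terms over SUB-FAMILIES of the index set ([ABKM19] Lemma 9.6)

`RenormalisationMapTermLipschitz.tayNormLE_sum_reblockTerm_sub` sums the hybrid (Lipschitz) bounds of the
reblocked terms `F₁^{U∖X}F₂^{X∖U}(F₃^{X₁}G(X∖X₁))` over `X ∈ 𝓧` and ALL `X₁ ∈ 𝓟_s(X)`.  The remainder
`S(H,K) − C_kK` of `RenormalisationMapRemainder.nextKStep_sub_opC_eq` is organised by sub-families of the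
pairs `(X, X₁)`: `X₁ ∈ 𝓟_s(X) ∖ {∅, X}` (fourth sum), `X₁ ∈ {∅, X}` for disconnected `X` (third sum), etc.
This file restates the abstract estimate for an arbitrary inner family `𝓨(X) ⊆ 𝓟_s(X)`; the proof is
that of the full sum verbatim.

* **`tayNormLE_subsum_reblockTerm_sub`**.

Everything is proved; no named fact.

## References
* S. Adams, S. Buchholz, R. Kotecký, S. Müller, arXiv:1910.13564, Lemma 9.6 (proof), Lemma 8.3 (iii)
  [AdamsBuchholzKoteckyMuller2019].
-/

noncomputable section

namespace Literature.MathematicalPhysics.StatisticalMechanics.GradientRG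

open scoped BigOperators Classical
open Finset
open Literature.MathematicalPhysics.StatisticalMechanics.TorusPolymer (IsPolymer blocks polys bprod mem_polys)
open Literature.MathematicalPhysics.QuantumFieldTheory

variable {d M : ℕ} [NeZero M]
  {V : Type*} [NormedAddCommGroup V] [NormedSpace ℝ V]
  {Vb : Finset (Fin d → ZMod M) → Type*} [∀ B, NormedAddCommGroup (Vb B)] [∀ B, NormedSpace ℝ (Vb B)]
  {Vp : Finset (Fin d → ZMod M) → Type*} [∀ Y, NormedAddCommGroup (Vp Y)] [∀ Y, NormedSpace ℝ (Vp Y)]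

/-- **The summed Lipschitz estimate over sub-families** ([ABKM19] Lemma 9.6 at first order; `RenormalisationMapTermLipschitz.tayNormLE_sum_reblockTerm_sub` with the inner sum over an arbitrary `𝓨(X) ⊆ 𝓟_s(X)`): for `s`-polymers `U` and
`X ∈ 𝓧`, block functionals `Fᵢ, Fᵢ'` bounded (by the same `aᵢ ≥ 0`, differences by `δᵢ ≥ 0`) on a set of
blocks `𝓑` containing all blocks of `U∖X`, `X∖U`, `X`, polymer functionals `G, G'` with
`|G(X∖X₁)| ≤ g(X∖X₁)`, `|G(X∖X₁) − G'(X∖X₁)| ≤ ρ(X∖X₁)` in `|·|_{T_{X∖X₁}, wm^{X∖X₁}}`, and the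
weight inequality `W^{U∖X} W^{X∖U} W^{X₁} wm^{X∖X₁} ≤ w`:
`|Σ_X Σ_{X₁} (F₁^{U∖X}F₂^{X∖U}F₃^{X₁}G(X∖X₁) − F₁'^{U∖X}F₂'^{X∖U}F₃'^{X₁}G'(X∖X₁))|_{T,w}
  ≤ Σ_X Σ_{X₁} [Δ₁a₂(a₃g) + a₁Δ₂(a₃g) + a₁a₂(Δ₃g) + a₁a₂(a₃ρ)]`.
[cite: AdamsBuchholzKoteckyMuller2019, Lemma 9.6 (proof, (9.40)–(9.43) at first order)] -/
theorem tayNormLE_subsum_reblockTerm_sub (s : ℕ) (T : ((Fin d → ZMod M) → ℝ) →ₗ[ℝ] V)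
    (Tb : ∀ B : Finset (Fin d → ZMod M), ((Fin d → ZMod M) → ℝ) →ₗ[ℝ] Vb B)
    (Tp : ∀ Y : Finset (Fin d → ZMod M), ((Fin d → ZMod M) → ℝ) →ₗ[ℝ] Vp Y) {r₀ : ℕ}
    {W wm : Finset (Fin d → ZMod M) → ((Fin d → ZMod M) → ℝ) → ℝ} {w : ((Fin d → ZMod M) → ℝ) → ℝ}
    {F₁ F₂ F₃ F₁' F₂' F₃' G G' : Finset (Fin d → ZMod M) → ((Fin d → ZMod M) → ℝ) → ℂ}
    {a₁ a₂ a₃ δ₁ δ₂ δ₃ g ρ : Finset (Fin d → ZMod M) → ℝ}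
    (𝓧 𝓑 : Finset (Finset (Fin d → ZMod M))) (𝓨 : Finset (Fin d → ZMod M) → Finset (Finset (Fin d → ZMod M)))
    {U : Finset (Fin d → ZMod M)} (hU : IsPolymer s U)
    (h𝓧 : ∀ X ∈ 𝓧, IsPolymer s X) (h𝓨 : ∀ X ∈ 𝓧, 𝓨 X ⊆ polys s X)
    (h𝓑₁ : ∀ X ∈ 𝓧, blocks s (U \ X) ⊆ 𝓑) (h𝓑₂ : ∀ X ∈ 𝓧, blocks s (X \ U) ⊆ 𝓑)
    (h𝓑₃ : ∀ X ∈ 𝓧, blocks s X ⊆ 𝓑)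
    (hle : ∀ B ∈ 𝓑, ∀ ξ, ‖Tb B ξ‖ ≤ ‖T ξ‖)
    (hF₁ : ∀ B ∈ 𝓑, TayNormLE (Tb B) r₀ (W B) (F₁ B) (a₁ B))
    (hF₁' : ∀ B ∈ 𝓑, TayNormLE (Tb B) r₀ (W B) (F₁' B) (a₁ B))
    (hΔ₁ : ∀ B ∈ 𝓑, TayNormLE (Tb B) r₀ (W B) (fun φ => F₁ B φ - F₁' B φ) (δ₁ B))
    (hF₁d : ∀ B ∈ 𝓑, ContDiff ℝ r₀ (F₁ B)) (hF₁'d : ∀ B ∈ 𝓑, ContDiff ℝ r₀ (F₁' B))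
    (hF₁loc : ∀ B ∈ 𝓑, IsGaugeLocal (Tb B) (F₁ B)) (hF₁'loc : ∀ B ∈ 𝓑, IsGaugeLocal (Tb B) (F₁' B))
    (ha₁ : ∀ B ∈ 𝓑, 0 ≤ a₁ B) (hδ₁ : ∀ B ∈ 𝓑, 0 ≤ δ₁ B)
    (hF₂ : ∀ B ∈ 𝓑, TayNormLE (Tb B) r₀ (W B) (F₂ B) (a₂ B))
    (hF₂' : ∀ B ∈ 𝓑, TayNormLE (Tb B) r₀ (W B) (F₂' B) (a₂ B))
    (hΔ₂ : ∀ B ∈ 𝓑, TayNormLE (Tb B) r₀ (W B) (fun φ => F₂ B φ - F₂' B φ) (δ₂ B))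
    (hF₂d : ∀ B ∈ 𝓑, ContDiff ℝ r₀ (F₂ B)) (hF₂'d : ∀ B ∈ 𝓑, ContDiff ℝ r₀ (F₂' B))
    (hF₂loc : ∀ B ∈ 𝓑, IsGaugeLocal (Tb B) (F₂ B)) (hF₂'loc : ∀ B ∈ 𝓑, IsGaugeLocal (Tb B) (F₂' B))
    (ha₂ : ∀ B ∈ 𝓑, 0 ≤ a₂ B) (hδ₂ : ∀ B ∈ 𝓑, 0 ≤ δ₂ B)
    (hF₃ : ∀ B ∈ 𝓑, TayNormLE (Tb B) r₀ (W B) (F₃ B) (a₃ B))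
    (hF₃' : ∀ B ∈ 𝓑, TayNormLE (Tb B) r₀ (W B) (F₃' B) (a₃ B))
    (hΔ₃ : ∀ B ∈ 𝓑, TayNormLE (Tb B) r₀ (W B) (fun φ => F₃ B φ - F₃' B φ) (δ₃ B))
    (hF₃d : ∀ B ∈ 𝓑, ContDiff ℝ r₀ (F₃ B)) (hF₃'d : ∀ B ∈ 𝓑, ContDiff ℝ r₀ (F₃' B))
    (hF₃loc : ∀ B ∈ 𝓑, IsGaugeLocal (Tb B) (F₃ B)) (hF₃'loc : ∀ B ∈ 𝓑, IsGaugeLocal (Tb B) (F₃' B))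
    (ha₃ : ∀ B ∈ 𝓑, 0 ≤ a₃ B) (hδ₃ : ∀ B ∈ 𝓑, 0 ≤ δ₃ B)
    (hG : ∀ X ∈ 𝓧, ∀ X₁ ∈ 𝓨 X, TayNormLE (Tp (X \ X₁)) r₀ (wm (X \ X₁)) (G (X \ X₁)) (g (X \ X₁)))
    (hΔG : ∀ X ∈ 𝓧, ∀ X₁ ∈ 𝓨 X,
      TayNormLE (Tp (X \ X₁)) r₀ (wm (X \ X₁)) (fun φ => G (X \ X₁) φ - G' (X \ X₁) φ) (ρ (X \ X₁)))
    (hGd : ∀ X ∈ 𝓧, ∀ X₁ ∈ 𝓨 X, ContDiff ℝ r₀ (G (X \ X₁)))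
    (hG'd : ∀ X ∈ 𝓧, ∀ X₁ ∈ 𝓨 X, ContDiff ℝ r₀ (G' (X \ X₁)))
    (hGloc : ∀ X ∈ 𝓧, ∀ X₁ ∈ 𝓨 X, IsGaugeLocal (Tp (X \ X₁)) (G (X \ X₁)))
    (hG'loc : ∀ X ∈ 𝓧, ∀ X₁ ∈ 𝓨 X, IsGaugeLocal (Tp (X \ X₁)) (G' (X \ X₁)))
    (hg : ∀ X ∈ 𝓧, ∀ X₁ ∈ 𝓨 X, 0 ≤ g (X \ X₁)) (hρ : ∀ X ∈ 𝓧, ∀ X₁ ∈ 𝓨 X, 0 ≤ ρ (X \ X₁))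
    (hlep : ∀ X ∈ 𝓧, ∀ X₁ ∈ 𝓨 X, ∀ ξ, ‖Tp (X \ X₁) ξ‖ ≤ ‖T ξ‖)
    (hw : ∀ X ∈ 𝓧, ∀ X₁ ∈ 𝓨 X, ∀ φ, (∏ B ∈ blocks s (U \ X), W B φ) *
      (∏ B ∈ blocks s (X \ U), W B φ) * ((∏ B ∈ blocks s X₁, W B φ) * wm (X \ X₁) φ) ≤ w φ) :
    TayNormLE T r₀ w
      (fun φ => ∑ X ∈ 𝓧, ∑ X₁ ∈ 𝓨 X,
        (bprod s (fun B => F₁ B φ) (U \ X) * bprod s (fun B => F₂ B φ) (X \ U) *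
            (bprod s (fun B => F₃ B φ) X₁ * G (X \ X₁) φ) -
          bprod s (fun B => F₁' B φ) (U \ X) * bprod s (fun B => F₂' B φ) (X \ U) *
            (bprod s (fun B => F₃' B φ) X₁ * G' (X \ X₁) φ)))
      (∑ X ∈ 𝓧, ∑ X₁ ∈ 𝓨 X,
        (((∏ B ∈ blocks s (U \ X), (a₁ B + δ₁ B)) - ∏ B ∈ blocks s (U \ X), a₁ B) *
            (∏ B ∈ blocks s (X \ U), a₂ B) * ((∏ B ∈ blocks s X₁, a₃ B) * g (X \ X₁)) +
          (∏ B ∈ blocks s (U \ X), a₁ B) *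
            ((∏ B ∈ blocks s (X \ U), (a₂ B + δ₂ B)) - ∏ B ∈ blocks s (X \ U), a₂ B) *
            ((∏ B ∈ blocks s X₁, a₃ B) * g (X \ X₁)) +
          (∏ B ∈ blocks s (U \ X), a₁ B) * (∏ B ∈ blocks s (X \ U), a₂ B) *
            (((∏ B ∈ blocks s X₁, (a₃ B + δ₃ B)) - ∏ B ∈ blocks s X₁, a₃ B) * g (X \ X₁)) +
          (∏ B ∈ blocks s (U \ X), a₁ B) * (∏ B ∈ blocks s (X \ U), a₂ B) *
            ((∏ B ∈ blocks s X₁, a₃ B) * ρ (X \ X₁)))) := by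
  have hcd : ∀ {F : Finset (Fin d → ZMod M) → ((Fin d → ZMod M) → ℝ) → ℂ} {Z : Finset (Fin d → ZMod M)},
      (∀ B ∈ blocks s Z, ContDiff ℝ r₀ (F B)) → ContDiff ℝ r₀ (fun φ => bprod s (fun B => F B φ) Z) := by
    intro F Z hF
    unfold TorusPolymer.bprod
    exact contDiff_prod fun B hB => hF B hB
  have hterm_cd : ∀ X ∈ 𝓧, ∀ X₁ ∈ 𝓨 X, ContDiff ℝ r₀ (fun φ =>
      bprod s (fun B => F₁ B φ) (U \ X) * bprod s (fun B => F₂ B φ) (X \ U) *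
          (bprod s (fun B => F₃ B φ) X₁ * G (X \ X₁) φ) -
        bprod s (fun B => F₁' B φ) (U \ X) * bprod s (fun B => F₂' B φ) (X \ U) *
          (bprod s (fun B => F₃' B φ) X₁ * G' (X \ X₁) φ)) := by
    intro X hX X₁ hX₁
    have h3sub : blocks s X₁ ⊆ 𝓑 := (TorusPolymer.blocks_mono s (mem_polys.1 (h𝓨 X hX hX₁)).1).trans (h𝓑₃ X hX)
    exact (((hcd fun B hB => hF₁d B (h𝓑₁ X hX hB)).mul (hcd fun B hB => hF₂d B (h𝓑₂ X hX hB))).mul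
        ((hcd fun B hB => hF₃d B (h3sub hB)).mul (hGd X hX X₁ hX₁))).sub
      (((hcd fun B hB => hF₁'d B (h𝓑₁ X hX hB)).mul (hcd fun B hB => hF₂'d B (h𝓑₂ X hX hB))).mul
        ((hcd fun B hB => hF₃'d B (h3sub hB)).mul (hG'd X hX X₁ hX₁)))
  refine TayNormLE.sum (T := T) (r₀ := r₀) (w := w) 𝓧 (fun X hX => ?_) (fun X hX => ?_)
  · refine TayNormLE.sum (T := T) (r₀ := r₀) (w := w) (𝓨 X) (fun X₁ hX₁ => ?_)
      (fun X₁ hX₁ => hterm_cd X hX X₁ hX₁)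
    have h3sub : blocks s X₁ ⊆ 𝓑 := (TorusPolymer.blocks_mono s (mem_polys.1 (h𝓨 X hX hX₁)).1).trans (h𝓑₃ X hX)
    exact tayNormLE_reblockTerm_sub s T Tb (Tp (X \ X₁)) hU (h𝓧 X hX) (h𝓨 X hX hX₁)
      (fun B hB => hF₁ B (h𝓑₁ X hX hB)) (fun B hB => hF₁' B (h𝓑₁ X hX hB))
      (fun B hB => hΔ₁ B (h𝓑₁ X hX hB)) (fun B hB => hF₁d B (h𝓑₁ X hX hB))
      (fun B hB => hF₁'d B (h𝓑₁ X hX hB)) (fun B hB => hF₁loc B (h𝓑₁ X hX hB))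
      (fun B hB => hF₁'loc B (h𝓑₁ X hX hB)) (fun B hB => ha₁ B (h𝓑₁ X hX hB))
      (fun B hB => hδ₁ B (h𝓑₁ X hX hB)) (fun B hB => hle B (h𝓑₁ X hX hB))
      (fun B hB => hF₂ B (h𝓑₂ X hX hB)) (fun B hB => hF₂' B (h𝓑₂ X hX hB))
      (fun B hB => hΔ₂ B (h𝓑₂ X hX hB)) (fun B hB => hF₂d B (h𝓑₂ X hX hB))
      (fun B hB => hF₂'d B (h𝓑₂ X hX hB)) (fun B hB => hF₂loc B (h𝓑₂ X hX hB))
      (fun B hB => hF₂'loc B (h𝓑₂ X hX hB)) (fun B hB => ha₂ B (h𝓑₂ X hX hB))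
      (fun B hB => hδ₂ B (h𝓑₂ X hX hB)) (fun B hB => hle B (h𝓑₂ X hX hB))
      (fun B hB => hF₃ B (h3sub hB)) (fun B hB => hF₃' B (h3sub hB))
      (fun B hB => hΔ₃ B (h3sub hB)) (fun B hB => hF₃d B (h3sub hB))
      (fun B hB => hF₃'d B (h3sub hB)) (fun B hB => hF₃loc B (h3sub hB))
      (fun B hB => hF₃'loc B (h3sub hB)) (fun B hB => ha₃ B (h3sub hB))
      (fun B hB => hδ₃ B (h3sub hB)) (fun B hB => hle B (h3sub hB))
      (hG X hX X₁ hX₁) (hΔG X hX X₁ hX₁) (hGd X hX X₁ hX₁) (hG'd X hX X₁ hX₁)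
      (hGloc X hX X₁ hX₁) (hG'loc X hX X₁ hX₁) (hg X hX X₁ hX₁) (hρ X hX X₁ hX₁) (hlep X hX X₁ hX₁)
      (hw X hX X₁ hX₁)
  · exact ContDiff.sum fun X₁ hX₁ => hterm_cd X hX X₁ hX₁

end Literature.MathematicalPhysics.StatisticalMechanics.GradientRG

end
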